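import Literature.NumberTheory.Automorphic.ArchLocalTorusOrbitalBlockSmooth             -- ★ p842196 (A1) (F0P3a-p05): `C^∞` in all the angles on the block-separated set (`b := id`: the regular set)
import Literature.NumberTheory.Rogawski1990.ArchCentralLimitFunctionalEngine            -- ★ p842373: the `Λ_x[·]` engine rules (`hΦ` shape of `tendsto_lambda8_rhoWeylDelta_finset_sum`)
import HarnessLib

/-!
# RAY SMOOTHNESS OF TORUS ORBITAL INTEGRALS AT REGULAR POINTS: along every ray `s ↦ x·e^{isu}` from a regular torus point `x`, the letter's ray function
# `s ↦ ρ′Δ(x·e^{isu}) · ∫_{G_w} Θ(g·diag(x·e^{isu})·g⁻¹) dν` is `C^∞` at `s = 0` (Rogawski 1990 §8.4 p. 126; the `C³` input of the 8-ray functional's additivity)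

Topic `NumberTheory/Rogawski1990`; namespace `Literature.NumberTheory.Rogawski1990`.  THEOREMS ONLY (no `def`, no instance, no notation, no axiom, no named fact, no `sorry`).
Cell `pub/hodgecm-mathlib`, ENGINE T1 (crux H413 = `stmt-HodgeConjecture-24833`); ROAD-Sd residual R4, SdArch ED. 3 node N5 «E2-central» §2a (F0P3a-p03 (g11)'s census 783c9612:
«`Λ_v` is linear over this finite sum at REGULAR `v` (each ray function `C³` at `s = 0`: ★ (A1) with `b := id` + the smooth ray)»); author F0P3a-p06 (g11).

WHAT IS PROVED.
* `isOpen_setOf_angles_regular` — for an injective `x : Fin 3 → S¹` the set of angles `{θ | ∀ i ≠ j, x_i e^{iθ_i} ≠ x_j e^{iθ_j}}` is open and contains `0`.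
* `contDiff_coe_ray` ∕ `contDiff_rhoWeylDelta_ray` — the coordinates `s ↦ ↑(x_k e^{isu_k})` and the Weyl factor `s ↦ ρ′Δ(x·e^{isu})` are `C^∞` on `ℝ` (circle points are non-zero).
* **`contDiffAt_integral_comp_conj_ray`** — `s ↦ ∫ Θ(↑↑(g·diag(x·e^{isu})·g⁻¹)) dν` is `C^∞` at `0` for `x` regular (★ (A1) `contDiffOn_integral_comp_conj_circleDiagonal_angles_of_blocks` with the
  trivial labelling `b := id`, composed with the linear ray `s ↦ s•u`).
* **`contDiffAt_ray_rhoWeylDelta_mul_integral_comp_conj`** — the product, `C^n` at `0` for every `n`; and **`contDiffAt_rays_rhoWeylDelta_mul_integral_family`** — the same packaged in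
  the EXACT binder shape `∀ x, Injective x → ∀ i ∈ I, ∀ ε, ContDiffAt ℝ 3 (fun s => (fun z′ => ρ′Δ z′ · Φ_i z′) (fun k => x k * Circle.exp (s * V_ε k))) 0` of ★ p842373's `hΦ` for a finite
  family of ambient test functions `Θ_i` (`Φ_i z′ = ∫ Θ_i ↑↑(g·diag z′·g⁻¹) dν`).
HONEST LABEL: HC_CM is proved only modulo the printed citations until rung 0 closes; this file is bookkeeping for R4's assembly and pays nothing by itself.

## References
* [Rogawski1990] J. D. Rogawski, *Automorphic Representations of Unitary Groups in Three Variables*, Ann. of Math. Stud. 123 (1990), §8.4 p. 126; §8.2 pp. 122–123.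
* [DeitmarEchterhoff2014] A. Deitmar, S. Echterhoff, *Principles of Harmonic Analysis*, 2nd ed. (2014), Lemma 9.3.3.
-/

set_option autoImplicit false

noncomputable section

open MeasureTheory Filter Topology Set Complex NumberField NumberField.InfinitePlace
open scoped ContDiff Matrix MatrixGroups
-- the scoped `L^∞`-operator norm on `M_N(ℂ)` (the cell's ambient-smooth convention)
open scoped Matrix.Norms.Operator

namespace Literature.NumberTheory.Rogawski1990

open Literature.NumberTheory.Automorphic Literature.NumberTheory.Automorphic.UnitaryGroup

/-! ## §1 Regular angles, smooth rays -/

section Rays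

/-- For a regular (injective) torus point `x`, the angle set `{θ | ∀ i j, i ≠ j → x_i e^{iθ_i} ≠ x_j e^{iθ_j}}` (★ (A1)'s block-separated set for the trivial labelling) is OPEN and contains `0`.
[cite: Rogawski1990, §8.4 p. 126] -/
theorem isOpen_setOf_angles_regular (x : Fin 3 → Circle) :
    IsOpen {θ : Fin 3 → ℝ | ∀ i j : Fin 3, (id i : Fin 3) ≠ id j → x i * Circle.exp (θ i) ≠ x j * Circle.exp (θ j)} := by
  have h : {θ : Fin 3 → ℝ | ∀ i j : Fin 3, (id i : Fin 3) ≠ id j → x i * Circle.exp (θ i) ≠ x j * Circle.exp (θ j)} =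
      ⋂ i : Fin 3, ⋂ j : Fin 3, {θ : Fin 3 → ℝ | i ≠ j → x i * Circle.exp (θ i) ≠ x j * Circle.exp (θ j)} := by
    ext θ; simp only [id, Set.mem_setOf_eq, Set.mem_iInter]
  rw [h]
  refine isOpen_iInter_of_finite fun i => isOpen_iInter_of_finite fun j => ?_
  by_cases hij : i = j
  · have : {θ : Fin 3 → ℝ | i ≠ j → x i * Circle.exp (θ i) ≠ x j * Circle.exp (θ j)} = Set.univ := by
      ext θ; simp [hij]
    rw [this]; exact isOpen_univ
  · have : {θ : Fin 3 → ℝ | i ≠ j → x i * Circle.exp (θ i) ≠ x j * Circle.exp (θ j)} = {θ : Fin 3 → ℝ | x i * Circle.exp (θ i) ≠ x j * Circle.exp (θ j)} := by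
      ext θ; simp [hij]
    rw [this]
    exact isOpen_ne_fun ((continuous_const.mul (Circle.exp.continuous.comp (continuous_apply i))))
      ((continuous_const.mul (Circle.exp.continuous.comp (continuous_apply j))))

/-- `0` is a regular angle when `x` is injective. [cite: Rogawski1990, §8.4 p. 126] -/
theorem zero_mem_setOf_angles_regular {x : Fin 3 → Circle} (hx : Function.Injective x) :
    (0 : Fin 3 → ℝ) ∈ {θ : Fin 3 → ℝ | ∀ i j : Fin 3, (id i : Fin 3) ≠ id j → x i * Circle.exp (θ i) ≠ x j * Circle.exp (θ j)} := by
  intro i j hij h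
  simp only [Pi.zero_apply, Circle.exp_zero, mul_one] at h
  exact hij (hx h)

/-- The coordinate `s ↦ ↑(x_k · e^{i s u_k}) = ↑x_k · exp(i s u_k)` of a circle ray is `C^∞` on `ℝ`. [cite: Rogawski1990, §8.4 p. 126] -/
theorem contDiff_coe_ray (x : Fin 3 → Circle) (u : Fin 3 → ℝ) (k : Fin 3) :
    ContDiff ℝ ∞ fun s : ℝ => ((x k * Circle.exp (s * u k) : Circle) : ℂ) := by
  have h : (fun s : ℝ => ((x k * Circle.exp (s * u k) : Circle) : ℂ)) = fun s : ℝ => (x k : ℂ) * Complex.exp (((s * u k : ℝ) : ℂ) * Complex.I) := by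
    funext s
    rw [Circle.coe_mul, Circle.coe_exp]
  rw [h]
  refine contDiff_const.mul ((Complex.contDiff_exp (𝕜 := ℝ)).comp ?_)
  exact (Complex.ofRealCLM.contDiff.comp (contDiff_id.mul contDiff_const)).mul contDiff_const

/-- The coordinates of a circle ray never vanish. [cite: Rogawski1990, §8.4 p. 126] -/
theorem coe_ray_ne_zero (x : Fin 3 → Circle) (u : Fin 3 → ℝ) (k : Fin 3) (s : ℝ) :
    ((x k * Circle.exp (s * u k) : Circle) : ℂ) ≠ 0 :=
  Circle.coe_ne_zero _

/-- **The Weyl factor along a ray is smooth**: `s ↦ ρ′Δ(x·e^{isu}) = ↑r₀(↑r₂)⁻¹(1 − ↑r₁(↑r₀)⁻¹)(1 − ↑r₂(↑r₁)⁻¹)(1 − ↑r₂(↑r₀)⁻¹)`, `r_k = x_k e^{isu_k}`, is `C^∞` on `ℝ`. [cite: Rogawski1990, §8.4 p. 126] -/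
theorem contDiff_rhoWeylDelta_ray (x : Fin 3 → Circle) (u : Fin 3 → ℝ) :
    ContDiff ℝ ∞ fun s : ℝ =>
      ((x 0 * Circle.exp (s * u 0) : Circle) : ℂ) * (((x 2 * Circle.exp (s * u 2) : Circle) : ℂ))⁻¹ *
        ((1 - ((x 1 * Circle.exp (s * u 1) : Circle) : ℂ) * (((x 0 * Circle.exp (s * u 0) : Circle) : ℂ))⁻¹) *
          (1 - ((x 2 * Circle.exp (s * u 2) : Circle) : ℂ) * (((x 1 * Circle.exp (s * u 1) : Circle) : ℂ))⁻¹) *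
          (1 - ((x 2 * Circle.exp (s * u 2) : Circle) : ℂ) * (((x 0 * Circle.exp (s * u 0) : Circle) : ℂ))⁻¹)) := by
  have h0 := contDiff_coe_ray x u 0
  have h1 := contDiff_coe_ray x u 1
  have h2 := contDiff_coe_ray x u 2
  have i0 := h0.inv (coe_ray_ne_zero x u 0)
  have i1 := h1.inv (coe_ray_ne_zero x u 1)
  have i2 := h2.inv (coe_ray_ne_zero x u 2)
  exact (h0.mul i2).mul (((contDiff_const.sub (h1.mul i0)).mul (contDiff_const.sub (h2.mul i1))).mul (contDiff_const.sub (h2.mul i0)))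

end Rays

/-! ## §2 The orbital integral along a ray at a regular point -/

section Orbital

variable (L : Type) [Field L] (α : Fin 3 → L) (w : {w : InfinitePlace L // IsComplex w})
  [MeasurableSpace (archLocal L 3 (Matrix.diagonal α) w)] [BorelSpace (archLocal L 3 (Matrix.diagonal α) w)]

/-- **THE TORUS ORBITAL INTEGRAL IS `C^∞` ALONG EVERY RAY AT A REGULAR POINT**: for `x` injective, `u` any direction, `Θ` ambient-smooth with compact support on `G_w`, `ν` finite on compacts,
`s ↦ ∫ Θ(↑↑(g·diag(x·e^{isu})·g⁻¹)) dν` is `C^∞` at `s = 0` (★ (A1) at the trivial labelling `b := id`: the regular set; composed with the linear ray `s ↦ s•u`).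
[cite: Rogawski1990, §8.4 p. 126] [cite: DeitmarEchterhoff2014, Lemma 9.3.3] -/
theorem contDiffAt_integral_comp_conj_ray (hα : ∀ i, α i ≠ 0) (hreal : ∀ i, (w.1.embedding (α i)).im = 0)
    (ν : Measure (archLocal L 3 (Matrix.diagonal α) w)) [IsFiniteMeasureOnCompacts ν]
    (Θ : Matrix (Fin 3) (Fin 3) ℂ → ℂ) (hΘ : ContDiff ℝ ∞ Θ) (hfc : HasCompactSupport fun k : archLocal L 3 (Matrix.diagonal α) w => Θ (((k : GL (Fin 3) ℂ) : Matrix (Fin 3) (Fin 3) ℂ)))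
    {x : Fin 3 → Circle} (hx : Function.Injective x) (u : Fin 3 → ℝ) :
    ContDiffAt ℝ ∞ (fun s : ℝ => ∫ g : archLocal L 3 (Matrix.diagonal α) w,
      Θ ((((g * ⟨circleDiagonal 3 (fun k => x k * Circle.exp (s * u k)), circleDiagonal_mem_archLocal_diagonal L 3 α w _⟩ * g⁻¹ :
        archLocal L 3 (Matrix.diagonal α) w) : GL (Fin 3) ℂ) : Matrix (Fin 3) (Fin 3) ℂ)) ∂ν) 0 := by
  have hOn := contDiffOn_integral_comp_conj_circleDiagonal_angles_of_blocks L 3 α w hα hreal (id : Fin 3 → Fin 3)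
    (fun i j hij hb => absurd hb hij) ν Θ hΘ hfc x
  have hAt : ContDiffAt ℝ ∞ (fun θ : Fin 3 → ℝ => ∫ g : archLocal L 3 (Matrix.diagonal α) w,
      Θ ((((g * ⟨circleDiagonal 3 fun i => x i * Circle.exp (θ i), circleDiagonal_mem_archLocal_diagonal L 3 α w _⟩ * g⁻¹ :
        archLocal L 3 (Matrix.diagonal α) w) : GL (Fin 3) ℂ) : Matrix (Fin 3) (Fin 3) ℂ)) ∂ν) 0 :=
    hOn.contDiffAt ((isOpen_setOf_angles_regular x).mem_nhds (zero_mem_setOf_angles_regular hx))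
  have hray : ContDiff ℝ ∞ fun s : ℝ => s • u := contDiff_id.smul contDiff_const
  have h0 : (fun s : ℝ => s • u) 0 = 0 := zero_smul ℝ u
  rw [← h0] at hAt
  have h := hAt.comp (0 : ℝ) hray.contDiffAt
  exact h

/-- **THE LETTER'S RAY FUNCTION IS `C^n` AT `0`** (every `n`, every direction `u`): `s ↦ ρ′Δ(x·e^{isu}) · ∫ Θ(↑↑(g·diag(x·e^{isu})·g⁻¹)) dν` at a regular `x`.
[cite: Rogawski1990, §8.4 p. 126] -/
theorem contDiffAt_ray_rhoWeylDelta_mul_integral_comp_conj (hα : ∀ i, α i ≠ 0) (hreal : ∀ i, (w.1.embedding (α i)).im = 0)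
    (ν : Measure (archLocal L 3 (Matrix.diagonal α) w)) [IsFiniteMeasureOnCompacts ν]
    (Θ : Matrix (Fin 3) (Fin 3) ℂ → ℂ) (hΘ : ContDiff ℝ ∞ Θ) (hfc : HasCompactSupport fun k : archLocal L 3 (Matrix.diagonal α) w => Θ (((k : GL (Fin 3) ℂ) : Matrix (Fin 3) (Fin 3) ℂ)))
    {x : Fin 3 → Circle} (hx : Function.Injective x) (u : Fin 3 → ℝ) (n : ℕ) :
    ContDiffAt ℝ n (fun s : ℝ => (fun z' : Fin 3 → Circle =>
        ((z' 0 : ℂ) * ((z' 2 : ℂ))⁻¹ * ((1 - (z' 1 : ℂ) * ((z' 0 : ℂ))⁻¹) * (1 - (z' 2 : ℂ) * ((z' 1 : ℂ))⁻¹) * (1 - (z' 2 : ℂ) * ((z' 0 : ℂ))⁻¹))) *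
          ∫ g : archLocal L 3 (Matrix.diagonal α) w,
            Θ ((((g * ⟨circleDiagonal 3 z', circleDiagonal_mem_archLocal_diagonal L 3 α w _⟩ * g⁻¹ : archLocal L 3 (Matrix.diagonal α) w) : GL (Fin 3) ℂ) : Matrix (Fin 3) (Fin 3) ℂ)) ∂ν)
        (fun k => x k * Circle.exp (s * u k))) 0 := by
  have h := ((contDiff_rhoWeylDelta_ray x u).contDiffAt (x := (0 : ℝ))).mul (contDiffAt_integral_comp_conj_ray L α w hα hreal ν Θ hΘ hfc hx u)
  exact h.of_le (by exact_mod_cast le_top)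

/-- **PACKAGED FOR THE ENGINE**: the `hΦ` hypothesis of ★ `tendsto_lambda8_rhoWeylDelta_finset_sum` ∕ `lambda8_rhoWeylDelta_finset_sum` for a finite family of ORBITAL test functions
`Φ_i z′ = ∫ Θ_i ↑↑(g·diag z′·g⁻¹) dν` at regular points (all 8 rays). [cite: Rogawski1990, §8.4 p. 126] -/
theorem contDiffAt_rays_rhoWeylDelta_mul_integral_family (hα : ∀ i, α i ≠ 0) (hreal : ∀ i, (w.1.embedding (α i)).im = 0)
    (ν : Measure (archLocal L 3 (Matrix.diagonal α) w)) [IsFiniteMeasureOnCompacts ν]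
    {ι : Type*} (I : Finset ι) (Θ : ι → Matrix (Fin 3) (Fin 3) ℂ → ℂ) (hΘ : ∀ i ∈ I, ContDiff ℝ ∞ (Θ i))
    (hfc : ∀ i ∈ I, HasCompactSupport fun k : archLocal L 3 (Matrix.diagonal α) w => Θ i (((k : GL (Fin 3) ℂ) : Matrix (Fin 3) (Fin 3) ℂ))) :
    ∀ x : Fin 3 → Circle, Function.Injective x → ∀ i ∈ I, ∀ ε : Fin 3 → Bool, ContDiffAt ℝ 3 (fun s : ℝ => (fun z' : Fin 3 → Circle =>
        ((z' 0 : ℂ) * ((z' 2 : ℂ))⁻¹ * ((1 - (z' 1 : ℂ) * ((z' 0 : ℂ))⁻¹) * (1 - (z' 2 : ℂ) * ((z' 1 : ℂ))⁻¹) * (1 - (z' 2 : ℂ) * ((z' 0 : ℂ))⁻¹))) *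
          (fun z'' : Fin 3 → Circle => ∫ g : archLocal L 3 (Matrix.diagonal α) w,
            Θ i ((((g * ⟨circleDiagonal 3 z'', circleDiagonal_mem_archLocal_diagonal L 3 α w _⟩ * g⁻¹ : archLocal L 3 (Matrix.diagonal α) w) : GL (Fin 3) ℂ) : Matrix (Fin 3) (Fin 3) ℂ)) ∂ν) z')
        (fun k => x k * Circle.exp (s * ![(if ε 0 then (1 : ℝ) else -1) + (if ε 1 then (1 : ℝ) else -1), -(if ε 0 then (1 : ℝ) else -1) + (if ε 2 then (1 : ℝ) else -1),
          -(if ε 1 then (1 : ℝ) else -1) - (if ε 2 then (1 : ℝ) else -1)] k))) 0 := by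
  intro x hx i hi ε
  exact contDiffAt_ray_rhoWeylDelta_mul_integral_comp_conj L α w hα hreal ν (Θ i) (hΘ i hi) (hfc i hi) hx _ 3

end Orbital

end Literature.NumberTheory.Rogawski1990

end
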